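import Summits.ResolutionOfSingularities.ResolutionOfSingularities.Theorems.FrobeniusClosingSteerPointStepsRecur
import Summits.ResolutionOfSingularities.ResolutionOfSingularities.Theorems.FrobeniusClosingSteerWords12MemberDatum
import Literature.AlgebraicGeometry.Resolution.RegularLocalOrderValuation
import HarnessLib

/-!
# Crux `Steer` (stmt-ResolutionOfSingularities-16345), chain W4.1 — **the CLEANED ORDER EXISTS** at every member of a σ_top-steered `p = 2` run
# (hS1b proof map (M1): `∀ i, ∃ ν, HasCleanedOrderAt R s 2 i ν`; Theses-free, def-free)

OURS (campaign `res-hironaka`, rung L ★L-G4, slot W4.1; seat res-D-lib-2 g10 on res-L0-w41-plan-1 RULING 264(d) = the hS1b kernel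
`ArithLeaf.EventuallyConstantReducedOrderTwoN`, res-L0-w41-strat-2 g4's PROOF MAP hS1b v0.9 step (M1) «cleaned order exists at every late point step —
CHECK whether a tree lemma exists; else type it as word W-CO»: no tree lemma existed (rg), this file proves it outright, at EVERY stage). Candidates, not
facts; nothing here is a statement of H. Hironaka's manuscript [Hironaka2017] (status: under review). AI-written; AI review is weaker than expert review.

* `exists_exact_cleanedOrder` — MEMBER LEMMA: in an excellent regular local ring `S` of characteristic `2`, an element `f` which is NOT a square has an
  EXACT cleaned order: some `f − g²` lies in `𝔪^ν` and none in `𝔪^(ν+1)`. Otherwise `f − g_n² ∈ 𝔪ⁿ` for all `n`; in characteristic `2`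
  `(g_{2n} − g_{2n+2})² = (f − g_{2n+2}²) − (f − g_{2n}²) ∈ 𝔪^(2n)`, so `a_n := g_{2n}` is `𝔪`-adically CAUCHY (`ord (x²) = 2·ord x` in a regular local
  ring, `Res.adicOrder_pow`) with `a_n² → f`; the tree's «a normal local G-ring is Frobenius-closed in its completion»
  (`CompletionFrobeniusClosed.exists_pow_eq_of_adicCauchy_of_isExcellentRing`) makes `f` a square in `S` ↯.
* `exists_hasCleanedOrderAt_of_run` — RUN LEVEL: along a σ_top-steered run of a core datum every member `R i` is regular (`Words.steeredMembersRegular_holds`),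
  excellent (`GeoDict.isExcellentRing_of_locChar` on a model `SteeredExit.exists_model_of_tower`), and `s i² ` is no square of `R i` by run hygiene
  (`RunHygiene.runHygieneTwo_of_steeredRun` (5): `s i` is no fraction of `R i`) ⇒ `∃ ν, HasCleanedOrderAt R s 2 i ν`.
[cite: Matsumura1987, §32 p. 260] [folklore]
-/

-- `Summit.<S>.<S>.…` duplicates the summit name by design (single-problem summit).
set_option linter.dupNamespace false

noncomputable section

open IsLocalRing
open Literature.AlgebraicGeometry.Resolution
open Summit.ResolutionOfSingularities.ResolutionOfSingularities.Theorems.SwitchingDichotomy.Words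

namespace Summit.ResolutionOfSingularities.ResolutionOfSingularities.Theorems.SwitchingDichotomy.CleanedOrderExists

/-! ## §1 Member level -/

/-- In a regular local ring, `x² ∈ 𝔪^(2n)` forces `x ∈ 𝔪ⁿ` (`ord (x²) = 2·ord x`). [folklore] -/
theorem mem_pow_of_sq_mem_pow_two_mul {S : Type} [CommRing S] [IsRegularLocalRing S] {x : S} {n : ℕ}
    (hx : x ^ 2 ∈ maximalIdeal S ^ (2 * n)) : x ∈ maximalIdeal S ^ n := by
  have h1 : ((2 * n : ℕ) : ℕ∞) ≤ adicOrder (x ^ 2) := (le_adicOrder_iff _ _).mpr hx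
  rw [adicOrder_pow] at h1
  refine (le_adicOrder_iff _ _).mp ?_
  by_cases htop : adicOrder x = ⊤
  · rw [htop]; exact le_top
  · obtain ⟨m, hm⟩ := ENat.ne_top_iff_exists.mp htop
    rw [← hm] at h1 ⊢
    have h2 : 2 * n ≤ 2 * m := by exact_mod_cast h1
    exact_mod_cast (by omega : n ≤ m)

/-- **MEMBER LEMMA: a non-square has an exact cleaned order.** In an excellent regular local ring `S` of characteristic `2`, if `f` is not a
square then for some `ν`: `f − g² ∈ 𝔪^ν` for some `g` and `f − g² ∉ 𝔪^(ν+1)` for every `g`. (Frobenius-closedness of a normal local G-ring in its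
completion, along the Cauchy sequence `g_{2n}`.) [cite: Matsumura1987, §32 p. 260] [folklore] -/
theorem exists_exact_cleanedOrder {S : Type} [CommRing S] [IsDomain S] [IsRegularLocalRing S] [CharP S 2]
    (hexc : IsExcellentRing S) (f : S) (hf : ∀ c : S, c ^ 2 ≠ f) :
    ∃ ν : ℕ, (∃ g : S, f - g ^ 2 ∈ maximalIdeal S ^ ν) ∧ ∀ g : S, f - g ^ 2 ∉ maximalIdeal S ^ (ν + 1) := by
  classical
  haveI : IsIntegrallyClosed S := isIntegrallyClosed_of_isRegularLocalRing S
  haveI : Fact (Nat.Prime 2) := ⟨Nat.prime_two⟩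
  by_contra hno
  push Not at hno
  -- approximants of every order
  have hall : ∀ n, ∃ g : S, f - g ^ 2 ∈ maximalIdeal S ^ n := by
    intro n
    induction n with
    | zero => exact ⟨0, by simp⟩
    | succ n ih => exact hno n ih
  choose g hg using hall
  have h2 : (2 : S) = 0 := CharTwo.two_eq_zero
  -- the Cauchy sequence `a n := g (2n)`
  have hsq : ∀ n, (g (2 * n) - g (2 * (n + 1))) ^ 2 ∈ maximalIdeal S ^ (2 * n) := by
    intro n
    have e : (g (2 * n) - g (2 * (n + 1))) ^ 2 = (f - g (2 * (n + 1)) ^ 2) - (f - g (2 * n) ^ 2) := by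
      linear_combination (g (2 * (n + 1)) * (g (2 * (n + 1)) - g (2 * n))) * h2
    rw [e]
    exact sub_mem (Ideal.pow_le_pow_right (by omega) (hg (2 * (n + 1)))) (hg (2 * n))
  have ha : ∀ n, g (2 * n) - g (2 * (n + 1)) ∈ maximalIdeal S ^ n := fun n => mem_pow_of_sq_mem_pow_two_mul (hsq n)
  have hfa : ∀ n, g (2 * n) ^ 2 - f ∈ maximalIdeal S ^ n := by
    intro n
    have h := Submodule.neg_mem _ (hg (2 * n))
    rw [neg_sub] at h
    exact Ideal.pow_le_pow_right (by omega) h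
  obtain ⟨c, hc⟩ := CompletionFrobeniusClosed.exists_pow_eq_of_adicCauchy_of_isExcellentRing hexc 2 f (fun n => g (2 * n))
    ha hfa
  exact hf c hc

/-! ## §2 Run level -/

variable {K : Type} [Field K]

/-- **Every member of a σ_top-steered `p = 2` run of a core datum has an exact cleaned order** (`∃ ν, HasCleanedOrderAt R s 2 i ν`): the member is
an excellent regular local ring of characteristic `2` and `s i²` is no square there by run hygiene. OURS. [cite: Matsumura1987, §32 p. 260] [folklore] -/
theorem exists_hasCleanedOrderAt_of_run {k : Type} [Field k] [CharP k 2] [PerfectField k] [Algebra k K]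
    (O : ValuationSubring K) (A₀ : Subalgebra k K) (h₀ : A₀.toSubring ≤ O.toSubring) (t : K)
    (core : CoreDatum 2 4 k K O A₀ h₀ t)
    (R : ℕ → Subring K) (P : (i : ℕ) → Ideal (R i)) (s : ℕ → K)
    (hR0 : R 0 = locAtCentre A₀.toSubring O) (hrun : IsSteeredRun O R P t 2 s) (i : ℕ) :
    ∃ ν : ℕ, HasCleanedOrderAt R s 2 i ν := by
  classical
  haveI : CharP K 2 := charP_of_injective_algebraMap (algebraMap k K).injective 2
  -- the run's clauses
  have hs0 : s 0 = t := hrun.1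
  haveI hRloc : ∀ i, IsLocalRing (R i) := fun i => (hrun.2 i).1
  have hsp : ∀ i, s i ^ 2 ∈ R i := fun i => (hrun.2 i).2.1
  have hbl : ∀ i, IsLocalBlowupAlong O (R i) (P i) (R (i + 1)) := fun i => (hrun.2 i).2.2.2.1
  have hst : ∀ i, ∃ x g : K, ((∃ hx : x ∈ R i, (⟨x, hx⟩ : R i) ∈ P i) ∧ x ≠ 0 ∧
      ∀ y : R i, y ∈ P i → O.valuation (y : K) ≤ O.valuation x) ∧ g ∈ R i ∧ s i = x * s (i + 1) + g :=
    fun i => (hrun.2 i).2.2.2.2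
  -- core rows
  obtain ⟨hfg, htp, hfr, hreg, -, h0, hdim, -, -, -, -, hc, htr, -⟩ := id core
  -- the member: regular, excellent
  haveI hregi : IsRegularLocalRing (R i) :=
    steeredMembersRegular_holds 2 Nat.prime_two 4 le_rfl k K O A₀ h₀ t core R P s i hR0
      ⟨hs0, fun j _ => hsp j, fun j _ => hrun.2 j⟩
  have hexc : IsExcellentRing (R i) := by
    obtain ⟨A₁, -, -, hfg₁, hRA₁⟩ := SteeredExit.exists_model_of_tower O A₀ h₀ hfg hR0 (N := i)
      (fun j _ => (hbl j).isLocalBlowup)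
    exact GeoDict.isExcellentRing_of_locChar O A₁ hfg₁ hRA₁ (P := maximalIdeal (R i)) (PointStepsRecur.locChar_self (R i))
  -- run hygiene: `s i` is no fraction of `R i`, so `s i²` is no square of `R i`
  obtain ⟨-, -, -, -, hfrac, -⟩ :=
    RunHygiene.runHygieneTwo_of_steeredRun O A₀ h₀ t hfg htp hfr hreg h0 hdim hc htr R P s hR0 hbl hst hs0
  have hf : ∀ c : R i, c ^ 2 ≠ (⟨s i ^ 2, hsp i⟩ : R i) := by
    intro c hc2
    have hK : ((c : R i) : K) ^ 2 = s i ^ 2 := by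
      have h := congrArg (fun z : R i => (z : K)) hc2
      simpa using h
    have hprod : (s i - (c : K)) * (s i + (c : K)) = 0 := by linear_combination (-1 : K) * hK
    rcases mul_eq_zero.mp hprod with h1 | h1
    · exact hfrac i c 1 (by simp) (by simp; linear_combination h1)
    · exact hfrac i (-c) 1 (by simp) (by push_cast; linear_combination h1)
  obtain ⟨ν, ⟨g, hg⟩, hexact⟩ := exists_exact_cleanedOrder hexc ⟨s i ^ 2, hsp i⟩ hf
  exact ⟨ν, hRloc i, hsp i, ⟨g, hg⟩, hexact⟩

end Summit.ResolutionOfSingularities.ResolutionOfSingularities.Theorems.SwitchingDichotomy.CleanedOrderExists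

end
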